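/-
Copyright (c) 2026 the pub-hodgecm-mathlib formalisation cell (harness21).  Prover seat hodgecm-mathlib-LH4-p06 (g3): Track A «(D-RAM) FOUR-FRAME» squad of crux H413, unit
U3_Laws, (KMS) road «MODULO κ-STAGE B» (dealer LH4-plan (g11) WORD #34 «κB-H core-hanging κ-sockets»): the ω-CONDUCTOR TOOLKIT every κ-Stage-B brick needs, 2026-09-04.
-/
import Literature.NumberTheory.LocalFields.WildQuadraticDatumNonNormUnit        -- ★ `exists_fixed_unit_not_norm_of_isRamifiedQuadraticDatum`, `exists_unit_nonnorm_dichotomy_of_isRamifiedQuadraticDatum`; brings ★ GradedSteps (`exists_norm_approx_below_break`, `mul_map_mul_map`, `v_eq_one_of_v_mul_map_eq_one`)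
import Literature.NumberTheory.LocalFields.WildQuadraticDatumNormSurjective     -- ★ `exists_mul_map_eq_of_isRamifiedQuadraticDatum` (deep fixed one-units are norms)
import Literature.NumberTheory.LocalFields.ValuedCompleteIsAdicComplete        -- ★ `isAdicComplete_valuedInteger_of_completeSpace`
import Literature.NumberTheory.Automorphic.UnitaryThreeFourFrameFamilyExists    -- ★ `normSign_of_isNorm`, `normSign_of_not_isNorm` (the sign `ω = normSign σ`)
import HarnessLib

/-!
# The norm-class sign `ω = normSign σ` of a RAMIFIED QUADRATIC DATUM on the σ-fixed units: CONDUCTOR `d` — `ω ≡ 1` on the fixed units `≡ 1 (mod ϖ^{2d−1})`, a fixed NON-norm unit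
# `≡ 1 (mod ϖ^{2d−2})`, and the vanishing of `Σ ω` over every complete irredundant system of representatives of a `U_F^{(2d−2)}`-stable set of fixed units
# (Serre, *Local Fields* V §3 Cor. 3, XV §2; datum currency)

Topic `NumberTheory/LocalFields`; namespace `Literature.NumberTheory.LocalFields.WildQuadraticDatum` (the one-field datum ★ `IsRamifiedQuadraticDatum σ ϖ d t`).  THEOREMS ONLY (no
definition, no instance, no notation, no named fact, no `sorry`); kernel lane `--supports stmt-HodgeConjecture-24833` (count-neutral).  Cell `pub/hodgecm-mathlib` (D-0151), crux H413,
Track A «(D-RAM) FOUR-FRAME», unit U3_Laws, (KMS) «MODULO κ-STAGE B» (LH4-p05 (g3) PLAN v1 §4: every κ-stratum brick is «ALIVE iff the pair depth ≥ the conductor», then a character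
sum): this file is that toolkit, in the letters the Stage-B bricks already use (`U_F(n)` = fixed units `u` with `|u − 1| ≤ |ϖ|^n`, E-exponent `n`).

WHAT IS PROVED (`hD : IsRamifiedQuadraticDatum σ ϖ d t`; `N z = z·σz`; `ω = normSign σ`).
* §1 `exists_unit_v_sub_mul_map_le` — BELOW THE BREAK EVERY FIXED UNIT IS A NORM TO ORDER `2(d−1)`: `∃ z, |z| = 1 ∧ |w − N z| ≤ exp(−2(d−1))` (★ `exists_norm_approx_below_break`
  iterated from `n = 0`; `|2| < 1`).
* §2 `exists_fixed_unit_not_norm_v_sub_one_le` — A NON-NORM AT THE BREAK: a fixed unit `c`, `|c − 1| ≤ |ϖ|^{2(d−1)}`, `c ∉ N(Kˣ)` (★ the depth-free non-norm `u₀` divided by its §1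
  approximation: `c = u₀ ∕ N z`).  So `ω` is NOT trivial on `U_F(2d−2)`.
* §3 `exists_mul_map_eq_of_fixed_of_v_sub_one_le_pred` — AT AND ABOVE THE CONDUCTOR EVERY FIXED UNIT IS A NORM: `σu = u`, `|u − 1| ≤ |ϖ|^{2d−1}` ⇒ `u ∈ N` (parity of fixed
  elements upgrades `2d − 1` to `2d`; ★ `exists_mul_map_eq_of_isRamifiedQuadraticDatum` on the complete `K`); `normSign_eq_one_of_fixed_of_v_sub_one_le`, `normSign_mul_eq_of_near`
  (`ω(x·u) = ω(x)`), `normSign_eq_of_near` (`ω(x′) = ω(x)` when `x′ ∈ x·U_F(2d−1)`).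
* §4 `exists_nonnorm_dichotomy`, `normSign_mul_of_fixed` (`ω(xy) = ω(x)ω(y)` on non-zero fixed elements, ★ NI2 rescaled), `normSign_mul_eq_neg_of_not_norm` — `ω(c·g) = −ω(g)` for a fixed non-norm `c`.
* §5 **`sum_normSign_repr_eq_zero`** — THE CHARACTER SUM: if `S` is a finite complete irredundant system of representatives modulo `𝔭^ρ` (`ρ ≥ 2d − 1`) of a set `A` of fixed units
  stable under multiplication by `U_F(2d−2)`, then `Σ_{g ∈ S} ω(g) = 0` (the involution `g ↦ rep(c·g)` flips `ω`); and **`sum_normSign_repr_eq_card_mul`** — if instead `A ⊆ x₀·U_F(2d−1)`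
  then `Σ_{g ∈ S} ω(g) = #S · ω(x₀)`.
HONEST LABEL: HC_CM is proved only modulo the 7 printed citations (2 remaining named inputs: hLiu418 = stmt-HodgeConjecture-24832, h413 = stmt-HodgeConjecture-24833) until rung 0
closes; unconditional local algebra, count-neutral.

## References
* [Serre1979] J.-P. Serre, *Local Fields*, GTM 67 (1979): Ch. V §3 Prop. 5, Cor. 2–3 pp. 85–87 (norm groups of a totally ramified cyclic extension of prime degree; the conductor),
  Ch. XV §2 (conductor via `U^{(n)}`).
* [NeukirchANT1999] J. Neukirch, *Algebraic Number Theory* (1999): Ch. V (1.3) (local norm index).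
-/

set_option autoImplicit false

noncomputable section

open WithZero
open scoped Valued
open Literature.NumberTheory.Automorphic.UnitaryThreeFourFrame

namespace Literature.NumberTheory.LocalFields.WildQuadraticDatum

variable {K : Type} [Field K] [Valued K ℤᵐ⁰] {σ : K →+* K} {ϖ : K} {d t : ℕ}

/-! ## §0 Small valuation letters -/

/-- A fixed element with `|x| ≤ exp(−(2m+1))` has `|x| ≤ exp(−(2m+2))` (fixed non-zero elements have even valuation). [cite: Serre1979, Ch. V §3 Prop. 5, Cor. 2–3 pp. 85–87] -/
theorem v_le_exp_even_of_fixed (hfix : ∀ x : K, σ x = x → x ≠ 0 → ∃ n : ℤ, Valued.v x = exp (2 * n)) {x : K} (hσx : σ x = x) (m : ℤ)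
    (hx : Valued.v x ≤ exp (-(2 * m + 1))) : Valued.v x ≤ exp (-(2 * m + 2)) := by
  by_cases hx0 : x = 0
  · rw [hx0, map_zero]; exact zero_le
  obtain ⟨n, hn⟩ := hfix x hσx hx0
  rw [hn, exp_le_exp] at hx ⊢
  omega

/-! ## §1 Below the break: every fixed unit is a norm to order `2(d − 1)` -/

/-- **EVERY FIXED UNIT IS A NORM MODULO `U_F(2d−2)`** (`|2| < 1`): for a fixed unit `w` there is a unit `z` with `|w − z·σz| ≤ exp(−2(d−1))` — ★ `exists_norm_approx_below_break`
(the graded norm maps below the break are onto) iterated `d − 1` times from `|w − 1| ≤ 1`. [cite: Serre1979, Ch. V §3 Prop. 5, Cor. 2–3 pp. 85–87] -/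
theorem exists_unit_v_sub_mul_map_le [Finite 𝓀[K]] (hD : IsRamifiedQuadraticDatum σ ϖ d t) (h2v : Valued.v (2 : K) < 1)
    {w : K} (hσw : σ w = w) (hw1 : Valued.v w = 1) :
    ∃ z : K, Valued.v z = 1 ∧ Valued.v (w - z * σ z) ≤ exp (-(2 * ((d - 1 : ℕ) : ℤ))) := by
  obtain ⟨hσ, hvσ, hϖ, hfix, hd, hd1, ht⟩ := hD
  -- induction on the level `n ≤ d − 1`
  have key : ∀ n : ℕ, n + 1 ≤ d → ∃ z : K, Valued.v z = 1 ∧ Valued.v (w - z * σ z) ≤ exp (-(2 * (n : ℤ))) := by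
    intro n
    induction n with
    | zero =>
      intro _
      refine ⟨1, by rw [map_one], ?_⟩
      rw [map_one, mul_one, Nat.cast_zero, mul_zero, neg_zero, exp_zero]
      exact (Valuation.map_sub _ _ _).trans (max_le hw1.le (by rw [map_one]))
    | succ n ih =>
      intro hn
      obtain ⟨z, hz1, hz⟩ := ih (by omega)
      have hz0 : z ≠ 0 := fun h => by rw [h, map_zero] at hz1; exact zero_ne_one hz1
      have hσz0 : σ z ≠ 0 := (map_ne_zero σ).2 hz0
      have hN1 : Valued.v (z * σ z) = 1 := by rw [map_mul, hvσ, hz1, mul_one]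
      have hN0 : z * σ z ≠ 0 := mul_ne_zero hz0 hσz0
      -- `w' := w ∕ N z` is a fixed unit with `|w' − 1| ≤ exp(−2n)`
      set w' : K := w / (z * σ z) with hw'
      have hσw' : σ w' = w' := by rw [hw', map_div₀, map_mul, hσ, hσw, mul_comm (σ z) z]
      have hw'1 : Valued.v w' = 1 := by rw [hw', map_div₀, hw1, hN1, div_one]
      have hw'sub : Valued.v (w' - 1) ≤ exp (-(2 * (n : ℤ))) := by
        rw [hw', div_sub_one hN0, map_div₀, hN1, div_one]; exact hz
      obtain ⟨z', hz'1, hz'⟩ := exists_norm_approx_below_break hσ hvσ hfix hϖ hd ht h2v (n := n) (by omega) hσw' hw'1 hw'sub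
      refine ⟨z * z', by rw [map_mul, hz1, hz'1, mul_one], ?_⟩
      have e : w - z * z' * σ (z * z') = (z * σ z) * (w' - z' * σ z') := by
        rw [map_mul, hw', mul_sub, mul_div_cancel₀ _ hN0]; ring
      rw [e, map_mul, hN1, one_mul]
      have e2 : (-(2 * ((n + 1 : ℕ) : ℤ)) : ℤ) = -(2 * (n : ℤ) + 2) := by push_cast; ring
      rw [e2]; exact hz'
  by_cases hd0 : d = 0
  · exact absurd hd0 (by omega)
  · exact key (d - 1) (by omega)

/-! ## §2 A fixed non-norm unit at the break level `2(d − 1)` -/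

/-- **A σ-FIXED NON-NORM UNIT `c ≡ 1 (mod ϖ^{2d−2})`** (`|2| < 1`): `ω` is NOT trivial on `U_F(2d−2)`.  (★ depth-free non-norm `u₀`, §1 `u₀ ≡ N z (mod ϖ^{2d−2})`, `c := u₀ ∕ N z`:
a norm times a non-norm is a non-norm.) [cite: Serre1979, Ch. V §3 Prop. 5, Cor. 2–3 pp. 85–87; Ch. XV §2] -/
theorem exists_fixed_unit_not_norm_v_sub_one_le [Finite 𝓀[K]] (hD : IsRamifiedQuadraticDatum σ ϖ d t) (h2v : Valued.v (2 : K) < 1) :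
    ∃ c : K, σ c = c ∧ Valued.v c = 1 ∧ Valued.v (c - 1) ≤ exp (-(2 * ((d - 1 : ℕ) : ℤ))) ∧ ¬ ∃ z : K, z * σ z = c := by
  have hσ := hD.1; have hvσ := hD.2.1
  obtain ⟨u₀, hσu₀, hu₀1, hu₀n⟩ := exists_fixed_unit_not_norm_of_v_two_lt_one σ ϖ d t hD h2v
  obtain ⟨z, hz1, hz⟩ := exists_unit_v_sub_mul_map_le hD h2v hσu₀ hu₀1
  have hz0 : z ≠ 0 := fun h => by rw [h, map_zero] at hz1; exact zero_ne_one hz1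
  have hN1 : Valued.v (z * σ z) = 1 := by rw [map_mul, hvσ, hz1, mul_one]
  have hN0 : z * σ z ≠ 0 := mul_ne_zero hz0 ((map_ne_zero σ).2 hz0)
  refine ⟨u₀ / (z * σ z), by rw [map_div₀, map_mul, hσ, hσu₀, mul_comm (σ z) z], by rw [map_div₀, hu₀1, hN1, div_one], ?_, ?_⟩
  · rw [div_sub_one hN0, map_div₀, hN1, div_one]; exact hz
  · rintro ⟨y, hy⟩
    exact hu₀n ⟨y * z, by rw [← mul_map_mul_map, hy, div_mul_cancel₀ _ hN0]⟩

/-! ## §3 At and above the conductor: every fixed unit `≡ 1 (mod ϖ^{2d−1})` is a norm -/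

/-- **`σu = u`, `|u − 1| ≤ |ϖ|^{2d−1}` ⇒ `u = z·σz`** on a complete `K` (fixed elements have even valuation, so the hypothesis is `|u − 1| ≤ |ϖ|^{2d}`; then ★
`exists_mul_map_eq_of_isRamifiedQuadraticDatum`).  Hence `ω ≡ 1` on `U_F(n)` for every `n ≥ 2d − 1`. [cite: Serre1979, Ch. V §3 Prop. 5, Cor. 2–3 pp. 85–87; Ch. XV §2] -/
theorem exists_mul_map_eq_of_fixed_of_v_sub_one_le_pred [CompleteSpace K] (hD : IsRamifiedQuadraticDatum σ ϖ d t)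
    {u : K} (hσu : σ u = u) {n : ℕ} (hn : 2 * d - 1 ≤ n) (hu : Valued.v (u - 1) ≤ Valued.v ϖ ^ n) : ∃ z : K, z * σ z = u := by
  have hϖ := hD.2.2.1; have hfix := hD.2.2.2.1; have hd1 := hD.2.2.2.2.2.1
  haveI := Literature.NumberTheory.LocalFields.isAdicComplete_valuedInteger_of_completeSpace hϖ
  have hσu1 : σ (u - 1) = u - 1 := by rw [map_sub, hσu, map_one]
  have h2d : Valued.v (u - 1) ≤ Valued.v ϖ ^ (2 * d) := by
    have h1 : Valued.v (u - 1) ≤ exp (-(2 * ((d : ℤ) - 1) + 1)) := by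
      refine hu.trans ?_
      rw [v_varpi_pow hϖ, exp_le_exp]; omega
    have h2 := v_le_exp_even_of_fixed hfix hσu1 ((d : ℤ) - 1) h1
    rw [v_varpi_pow hϖ]
    refine h2.trans ?_
    rw [exp_le_exp]; push_cast; omega
  obtain ⟨z, hz, -⟩ := exists_mul_map_eq_of_isRamifiedQuadraticDatum σ ϖ d t hD u hσu h2d
  exact ⟨z, hz⟩

/-- **`ω(u) = 1` for a fixed `u` with `|u − 1| ≤ |ϖ|^n`, `n ≥ 2d − 1`.** [cite: Serre1979, Ch. XV §2] -/
theorem normSign_eq_one_of_fixed_of_v_sub_one_le [CompleteSpace K] (hD : IsRamifiedQuadraticDatum σ ϖ d t)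
    {u : K} (hσu : σ u = u) {n : ℕ} (hn : 2 * d - 1 ≤ n) (hu : Valued.v (u - 1) ≤ Valued.v ϖ ^ n) : normSign σ u = 1 :=
  normSign_of_isNorm σ (exists_mul_map_eq_of_fixed_of_v_sub_one_le_pred hD hσu hn hu)

/-- **`ω(x·u) = ω(x)` for a fixed `u` with `|u − 1| ≤ |ϖ|^n`, `n ≥ 2d − 1`** (such `u` is a norm). [cite: Serre1979, Ch. XV §2] -/
theorem normSign_mul_eq_of_fixed_of_v_sub_one_le [CompleteSpace K] (hD : IsRamifiedQuadraticDatum σ ϖ d t) (x : K)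
    {u : K} (hσu : σ u = u) {n : ℕ} (hn : 2 * d - 1 ≤ n) (hu : Valued.v (u - 1) ≤ Valued.v ϖ ^ n) : normSign σ (x * u) = normSign σ x := by
  obtain ⟨z, hz⟩ := exists_mul_map_eq_of_fixed_of_v_sub_one_le_pred hD hσu hn hu
  have hz0 : z ≠ 0 := by
    rintro rfl
    rw [zero_mul] at hz
    have h := hu
    rw [← hz, zero_sub, Valuation.map_neg, map_one] at h
    have h1 : Valued.v ϖ ^ n < 1 := by
      rw [v_varpi_pow hD.2.2.1, ← exp_zero, exp_lt_exp]
      have := hD.2.2.2.2.2.1; omega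
    exact absurd (h.trans_lt h1) (lt_irrefl _)
  rw [← hz]
  -- multiplying by the norm `z·σz` does not change `ω`
  by_cases hx : ∃ y : K, y * σ y = x
  · obtain ⟨y, hy⟩ := hx
    rw [normSign_of_isNorm σ ⟨y, hy⟩, normSign_of_isNorm σ ⟨y * z, by rw [map_mul, ← hy]; ring⟩]
  · rw [normSign_of_not_isNorm σ hx, normSign_of_not_isNorm σ ?_]
    rintro ⟨y, hy⟩
    have hσz : σ z ≠ 0 := (map_ne_zero σ).2 hz0
    refine hx ⟨y / z, ?_⟩
    rw [map_div₀, div_mul_div_comm, hy]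
    field_simp

/-- **`ω` IS CONSTANT ON `U_F(n)`-CLASSES, `n ≥ 2d − 1`**: fixed units `g, g′` with `|g − g′| ≤ |ϖ|^n` have `ω(g′) = ω(g)` (`g′ = g·(g′∕g)`). [cite: Serre1979, Ch. XV §2] -/
theorem normSign_eq_of_near [CompleteSpace K] (hD : IsRamifiedQuadraticDatum σ ϖ d t) {g g' : K} (hσg : σ g = g) (hσg' : σ g' = g')
    (hg : Valued.v g = 1) {n : ℕ} (hn : 2 * d - 1 ≤ n) (h : Valued.v (g - g') ≤ Valued.v ϖ ^ n) : normSign σ g' = normSign σ g := by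
  have hg0 : g ≠ 0 := fun h0 => by rw [h0, map_zero] at hg; exact zero_ne_one hg
  have e : g' = g * (g' / g) := by field_simp
  have hσq : σ (g' / g) = g' / g := by rw [map_div₀, hσg, hσg']
  have hq : Valued.v (g' / g - 1) ≤ Valued.v ϖ ^ n := by
    have e2 : g' / g - 1 = -((g - g') / g) := by field_simp; ring
    rw [e2, Valuation.map_neg, map_div₀, hg, div_one]; exact h
  rw [e, normSign_mul_eq_of_fixed_of_v_sub_one_le hD g hσq hn hq]

/-! ## §4 Multiplicativity of `ω` on the fixed elements; a fixed non-norm flips `ω` -/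

/-- **THE INDEX-TWO DICHOTOMY FOR ALL NON-ZERO FIXED ELEMENTS WITH A NON-NORM WITNESS** on a complete `K` with finite residue field: a fixed non-norm `c₀` such that every
non-zero fixed `x` is a norm or `c₀·x` is (★ NI2 on the fixed units, rescaled by the norms `N(ϖ^m)` through the even-valuation clause of the datum).
[cite: Serre1979, Ch. V §3 Cor. 3; Ch. XV §2] [cite: NeukirchANT1999, Ch. V (1.3)] -/
theorem exists_nonnorm_dichotomy [CompleteSpace K] [Finite 𝓀[K]] (hD : IsRamifiedQuadraticDatum σ ϖ d t) :
    ∃ c₀ : K, σ c₀ = c₀ ∧ (¬ ∃ z : K, z * σ z = c₀) ∧ ∀ x : K, σ x = x → x ≠ 0 → (∃ z : K, z * σ z = x) ∨ ∃ z : K, z * σ z = c₀ * x := by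
  have hσ := hD.1
  haveI := Literature.NumberTheory.LocalFields.isAdicComplete_valuedInteger_of_completeSpace hD.2.2.1
  obtain ⟨c₀, hσc₀, -, hc₀n, hdich₀⟩ := exists_unit_nonnorm_dichotomy_of_isRamifiedQuadraticDatum σ ϖ d t hD
  refine ⟨c₀, hσc₀, hc₀n, ?_⟩
  obtain ⟨-, hvσ, hϖ, heven, -, -, -⟩ := hD
  intro x hσx hx0
  obtain ⟨n, hn⟩ := heven x hσx hx0
  have hϖ0 : ϖ ≠ 0 := fun h => by rw [h, map_zero] at hϖ; exact (exp_ne_zero hϖ.symm).elim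
  have hσπ : σ (ϖ * σ ϖ) = ϖ * σ ϖ := by rw [map_mul, hσ, mul_comm]
  have hπ0 : ϖ * σ ϖ ≠ 0 := mul_ne_zero hϖ0 ((map_ne_zero σ).2 hϖ0)
  have hvπ : Valued.v (ϖ * σ ϖ) = exp (-2 : ℤ) := by rw [map_mul, hvσ, hϖ, ← exp_add]; norm_num
  set u : K := x * (ϖ * σ ϖ) ^ n with hu
  have hσu : σ u = u := by rw [hu, map_mul, map_zpow₀, hσx, hσπ]
  have hvu : Valued.v u = 1 := by
    rw [hu, map_mul, map_zpow₀, hn, hvπ, ← exp_zsmul, ← exp_add, ← exp_zero]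
    congr 1; simp only [smul_eq_mul]; ring
  have hN : ϖ ^ (-n) * σ (ϖ ^ (-n)) = ((ϖ * σ ϖ) ^ n)⁻¹ := by rw [map_zpow₀, ← mul_zpow, zpow_neg]
  have hx : x = u * (ϖ ^ (-n) * σ (ϖ ^ (-n))) := by
    rw [hN, hu, mul_assoc, mul_inv_cancel₀ (zpow_ne_zero n hπ0), mul_one]
  rcases hdich₀ u hσu hvu with ⟨z, hz⟩ | ⟨z, hz⟩
  · exact Or.inl ⟨z * ϖ ^ (-n), by rw [← mul_map_mul_map, hz, ← hx]⟩
  · exact Or.inr ⟨z * ϖ ^ (-n), by rw [← mul_map_mul_map, hz, hx, mul_assoc]⟩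

/-- **`ω` IS MULTIPLICATIVE ON THE NON-ZERO FIXED ELEMENTS** of a ramified quadratic datum over a complete `K` with finite residue field: `ω(xy) = ω(x)ω(y)`.
[cite: Serre1979, Ch. V §3 Cor. 3; Ch. XV §2] [cite: NeukirchANT1999, Ch. V (1.3)] -/
theorem normSign_mul_of_fixed [CompleteSpace K] [Finite 𝓀[K]] (hD : IsRamifiedQuadraticDatum σ ϖ d t)
    {x y : K} (hσx : σ x = x) (hσy : σ y = y) (hx0 : x ≠ 0) (hy0 : y ≠ 0) : normSign σ (x * y) = normSign σ x * normSign σ y := by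
  obtain ⟨c₀, hσc₀, hc₀n, hdich⟩ := exists_nonnorm_dichotomy hD
  exact normSign_mul_of_dichotomy σ hσc₀ hc₀n hdich hσx hσy hx0 hy0

/-- **A FIXED NON-NORM FLIPS `ω`**: if `c` is fixed and not a norm then `ω(c·g) = −ω(g)` for every fixed `g ≠ 0`. [cite: Serre1979, Ch. V §3 Cor. 3; Ch. XV §2] -/
theorem normSign_mul_eq_neg_of_not_norm [CompleteSpace K] [Finite 𝓀[K]] (hD : IsRamifiedQuadraticDatum σ ϖ d t)
    {c : K} (hσc : σ c = c) (hcn : ¬ ∃ z : K, z * σ z = c) {g : K} (hσg : σ g = g) (hg0 : g ≠ 0) :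
    normSign σ (c * g) = -normSign σ g := by
  have hc0 : c ≠ 0 := fun h => hcn ⟨0, by rw [h, zero_mul]⟩
  rw [normSign_mul_of_fixed hD hσc hσg hc0 hg0, normSign_of_not_isNorm σ hcn]
  ring

/-! ## §5 Character sums over complete irredundant systems of representatives -/

/-- **`Σ_{g ∈ S} ω(g) = 0`** — for a complete `K` with finite residue field, `|2| < 1`, `ρ ≥ 2d − 1`, a set `A` of fixed units STABLE under multiplication by `U_F(2d−2)`, and a finite
`S ⊆ A` which is a COMPLETE IRREDUNDANT system of representatives of `A` modulo `𝔭^ρ`: the sign sums to zero (the involution `g ↦ rep(c·g)`, `c` the §2 non-norm in `U_F(2d−2)`,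
permutes `S` and flips `ω`, §3–§4). [cite: Serre1979, Ch. V §3 Cor. 3; Ch. XV §2] [cite: NeukirchANT1999, Ch. V (1.3)] -/
theorem sum_normSign_repr_eq_zero [CompleteSpace K] [Finite 𝓀[K]] (hD : IsRamifiedQuadraticDatum σ ϖ d t) (h2v : Valued.v (2 : K) < 1)
    {ρ : ℕ} (hρ : 2 * d - 1 ≤ ρ) {A : Set K} (hA : ∀ f ∈ A, σ f = f ∧ Valued.v f = 1)
    (hAst : ∀ f ∈ A, ∀ a : K, σ a = a → Valued.v a = 1 → Valued.v (a - 1) ≤ exp (-(2 * ((d - 1 : ℕ) : ℤ))) → a * f ∈ A)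
    (S : Finset K) (hS1 : ∀ g ∈ S, g ∈ A) (hS2 : ∀ f ∈ A, ∃ g ∈ S, Valued.v (f - g) ≤ Valued.v ϖ ^ ρ)
    (hS3 : ∀ g ∈ S, ∀ g' ∈ S, Valued.v (g - g') ≤ Valued.v ϖ ^ ρ → g = g') :
    ∑ g ∈ S, normSign σ g = 0 := by
  classical
  have hσ := hD.1; have hvσ := hD.2.1; have hϖ := hD.2.2.1
  obtain ⟨c, hσc, hc1, hcd, hcn⟩ := exists_fixed_unit_not_norm_v_sub_one_le hD h2v
  -- the representative map `φ g := rep(c·g)`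
  have hrep : ∀ g ∈ S, ∃ g' ∈ S, Valued.v (c * g - g') ≤ Valued.v ϖ ^ ρ := fun g hg => hS2 (c * g) (hAst g (hS1 g hg) c hσc hc1 hcd)
  choose! φ hφS hφ using hrep
  -- `ω(φ g) = −ω(g)`
  have hflip : ∀ g ∈ S, normSign σ (φ g) = -normSign σ g := by
    intro g hg
    obtain ⟨hσg, hvg⟩ := hA g (hS1 g hg)
    have hg0 : g ≠ 0 := fun h0 => by rw [h0, map_zero] at hvg; exact zero_ne_one hvg
    have hσcg : σ (c * g) = c * g := by rw [map_mul, hσc, hσg]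
    have hvcg : Valued.v (c * g) = 1 := by rw [map_mul, hc1, hvg, mul_one]
    rw [normSign_eq_of_near hD hσcg (hA _ (hS1 _ (hφS g hg))).1 hvcg hρ (hφ g hg), normSign_mul_eq_neg_of_not_norm hD hσc hcn hσg hg0]
  -- `φ` maps `S` to `S` injectively, hence bijectively
  have hinj : ∀ g₁ ∈ S, ∀ g₂ ∈ S, φ g₁ = φ g₂ → g₁ = g₂ := by
    intro g₁ hg₁ g₂ hg₂ heq
    have hc0 : c ≠ 0 := fun h0 => by rw [h0, map_zero] at hc1; exact zero_ne_one hc1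
    apply hS3 g₁ hg₁ g₂ hg₂
    have h1 := hφ g₁ hg₁; have h2 := hφ g₂ hg₂
    rw [heq] at h1
    have e : g₁ - g₂ = c⁻¹ * ((c * g₁ - φ g₂) - (c * g₂ - φ g₂)) := by field_simp; ring
    rw [e, map_mul, map_inv₀, hc1, inv_one, one_mul]
    exact (Valuation.map_sub _ _ _).trans (max_le h1 h2)
  have hsum : ∑ g ∈ S, normSign σ (φ g) = ∑ g ∈ S, normSign σ g :=
    Finset.sum_bij (fun g _ => φ g) (fun g hg => hφS g hg) (fun g₁ hg₁ g₂ hg₂ h => hinj g₁ hg₁ g₂ hg₂ h)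
      (fun g' hg' => by
        -- surjectivity from injectivity on a finite set
        have himg : (S.image φ) = S := Finset.eq_of_subset_of_card_le (Finset.image_subset_iff.2 fun g hg => hφS g hg)
          (by rw [Finset.card_image_of_injOn (fun g₁ hg₁ g₂ hg₂ h => hinj g₁ hg₁ g₂ hg₂ h)])
        have hg'' : g' ∈ S.image φ := by rw [himg]; exact hg'
        obtain ⟨g, hg, hgg'⟩ := Finset.mem_image.1 hg''
        exact ⟨g, hg, hgg'⟩)
      (fun _ _ => rfl)
  have hneg : ∑ g ∈ S, normSign σ (φ g) = -∑ g ∈ S, normSign σ g := by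
    rw [← Finset.sum_neg_distrib]; exact Finset.sum_congr rfl hflip
  have h2 : (2 : ℤ) * ∑ g ∈ S, normSign σ g = 0 := by linarith
  simpa using h2

/-- **`Σ_{g ∈ S} ω(g) = #S · ω(x₀)`** when every element of `S` lies in the `U_F(2d−1)`-coset of a fixed unit `x₀` (`ω` is constant there, §3). [cite: Serre1979, Ch. XV §2] -/
theorem sum_normSign_eq_card_mul_of_near [CompleteSpace K] (hD : IsRamifiedQuadraticDatum σ ϖ d t) {x₀ : K} (hσx₀ : σ x₀ = x₀) (hx₀ : Valued.v x₀ = 1)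
    {n : ℕ} (hn : 2 * d - 1 ≤ n) (S : Finset K) (hS : ∀ g ∈ S, σ g = g ∧ Valued.v (x₀ - g) ≤ Valued.v ϖ ^ n) :
    ∑ g ∈ S, normSign σ g = (S.card : ℤ) * normSign σ x₀ := by
  rw [Finset.sum_congr rfl fun g hg => normSign_eq_of_near hD hσx₀ (hS g hg).1 hx₀ hn (hS g hg).2, Finset.sum_const, nsmul_eq_mul]

end Literature.NumberTheory.LocalFields.WildQuadraticDatum

end
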